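import Literature.MathematicalPhysics.QuantumFieldTheory.Balaban1983to89.B6Prop23MultiLevelBoxL0
import Literature.MathematicalPhysics.QuantumFieldTheory.Balaban1983to89.B6Prop22KLevelCensusEtaUnifL0
import Literature.MathematicalPhysics.QuantumFieldTheory.Balaban1983to89.B6Ineq288Edge

/-!
# `Balaban1983to89.B6Prop23KLevelCensusL0` — LEVEL-0 TWIN (programme G-F3′-L0, director-ym LINE №27 / UV3-NODE §24.5; plan `lit-balaban-r03/G-F3L0-PLAN.md`) of `B6Prop23KLevelCensus`:
the same declarations, SAME NAMES AND STATEMENTS, for nested families WITH print's region `Λ₀ = T ∖ Ω₁` ADMITTED (structures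
`B6MultiLevelBoxOperatorL0.Domains` / `B6MultiLevelTorusOperatorL0.TDomains`: levels `0, …, k`, the level-`0` block a single site, `Q′₀ = id`,
finite weight `a₀` — print p.225 (2.14) «Σ_{j=0}^k … (Q′₀λ)(x) = λ(x), x ∈ Λ₀», p.229 «taking a sequence (2.1) … smallest possible domains B^j(Λ_j),
and considering the operator Δ_a defined by (2.19), (2.20) for this sequence»).  Every `D`-free object is the lineage's, consumed BY NAME; no existing
module is touched; no fact is minted.  CENSUS CONVENTION OF THE L0 LINEAGE (`B6Prop22KLevelCensusL0.KIdx.G`): the member՚s weights are `fun j => aPrinted ℓ 1 (j + 1)` — level `j` carries print՚s `a_{j+1}`, the finest level `Λ₀` carries `a = 1`, `c ≡ 1` — so EVERY weight incl. the level-`0` one is genuine and positive (§1 `mlOp_mul_gml_member` is `mlOp_mul_gml`, no `mlOp_congr_weights`); `Xop`/`Ginv`/`CinvP` below are those of THIS operator, the one of `prop22Printed_kLevelP` (so §3 combines Prop. 2.2 and Prop. 2.3 of the same `G′`).  Unit `lit-balaban-p21` (packet S-B owner, S-C tail; p21 gen 27; port tooling by r03 gen 36 / p33 gen 88); B6 fold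 owner r03; referee ref-4.  THE TWIN'S DOCUMENTATION FOLLOWS
VERBATIM (its «levels 1 … k» / «Ω₁ = X» sentences describe the twin; here `j` runs from `0` and `Ω₁` may be a proper subset).

# `Balaban1983to89.B6Prop23KLevelCensus` — [B6] PROPOSITION 2.3 (2.86)–(2.87) IN THE CENSUS TYPING `B6.Prop23Printed`
ON THE GENUINE `k`-LEVEL FAMILY IN PRINT'S UNITS: the named fact of the census module `…B6` INHABITED by the family of all
nested box families `KIdx d ℓ` (gen 12's `B6Prop22KLevelCensusEtaL0.geoP`, `η = L^{−k}`) with the carrier kernel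
`Cinv i` = THE (2.69)-kernel of `(Q′G′²Q′*)⁻¹` of the member (file 6 of the multi-level `(Q′G′²Q′*)⁻¹` programme; no
existing module is touched; no fact is minted)

FRAMING (verbatim cell line):
statement-level skeleton of published theorems with citation tags; proofs where landed; nothing here is a claim about the Yang–Mills mass gap

Source under audit (cell pub-balaban / lit-balaban): T. Bałaban, *Propagators and renormalization transformations for
lattice gauge theories. II*, Commun. Math. Phys. **96** (1984) 223–250 [`Balaban1984PropagatorsII`, "B6"], p. 238 [PDF 16]
(Proposition 2.3, (2.86)–(2.87)), p. 235 [PDF 13] ((2.69)–(2.70)) — materialised text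
`paper:balaban1984-cmp96-propagators-rt-ii` p0013, p0016 re-read this generation.  Unit `lit-balaban-p21` (Phase-2 proof
seat p21 gen 13), HOME `run/shared/lean/pub/lit-balaban/`, B6 fold owner r03, referee ref-4.

## WHAT IS PRINTED (p. 238, verbatim up to notation)

«**Proposition 2.3.** An inverse of the operator Q′G′²Q′* is given by the convergent expansion (Q′G′²Q′*)⁻¹ =
C(I − R)⁻¹ = Σ_{n=0}^∞ CRⁿ = …, (2.86) and it satisfies the estimate |(Q′G′²Q′*)⁻¹(y, y′)| ≤
O(1)(L^jη)^{−4}(L^{j′}η)^{−d}e^{−½δ₁d(y,y′)}, y, y′ ∈ 𝔅, y ∈ Λ_j, y′ ∈ Λ_{j′}. (2.87)»  — typed verbatim by the census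
module as `B6.Prop23Printed d geo Cinv` («∃ M₁ δ₁ C > 0, ∀ i, (2.1)–(2.2) → M₁ ≤ M → ∀ y y′, |Cinv(y, y′)| ≤
C(L^jη)^{−4}(L^{j′}η)^{−d}e^{−½δ₁d(y,y′)}»).

## WHAT THIS FILE CERTIFIES (kernel-checked)

* §1 for EVERY member `i : KIdx d ℓ` (a nested family `D` on the fine box with `k ≥ 1` levels, `M_h ≥ 1`, `R ≥ 2L`,
  `P_μ ≥ 1`, the printed weights `a_j = aPrinted 1`): the operator `K_W(X) = Q′G′²Q′*` on `ℝ^𝔅` (`Xop`, `X` = the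
  (2.69)-kernel `B6Ineq268MultiLevelBoxL0.Xk`, `G′ = gml` genuine) is INJECTIVE (`⟨f, Xf⟩_W = ‖G′Q′*f‖²`,
  `B6Ineq281MultiLevelBoxL0.wform_Xk`, `G′` and `Q′*` injective) hence invertible (`Xop_isUnit`); `Ginv` = its inverse,
  `Ginv·K_W(X) = 1` (`Ginv_mul`); the carrier kernel IN PRINT'S UNITS `Cinv i (y, y′) = η^{−4−(d+1)}·Ginv(y, y′)/(L^{j′})^{d+1}`
  (`CinvP`: `G′ ↦ η²G′`, the pairing weight `(L^jη)^{d+1} = η^{d+1}W`);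
* §2 **`prop23Printed_kLevelP : B6.Prop23Printed (d + 1) (fun i : KIdx d ℓ => geoP i) (fun i => CinvP i)`** — the
  printed Proposition 2.3 in the census typing, for the lattice dimension `d + 1`, on the genuine `k`-level family in
  print's units, with witnesses `(M₁, δ₁, C)` from `B6Prop23MultiLevelBoxL0.prop23_multiLevelBox` (the unique inverse
  there IS `Ginv`, by uniqueness) and the rescaling `(L^jη)^{−4}(L^{j′}η)^{−(d+1)} = η^{−4−(d+1)}(L^j)^{−4}(L^{j′})^{−(d+1)}`;
  `prop23Printed_kLevelP_nonvacuous` — members above any threshold with `k` genuine levels exist (gen 12's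
  `kLevelP_nonvacuous`), so the inhabited fact is not vacuous;
* §3 `ineq288_edge_kLevelP` — the census DAG edge «Prop. 2.2 ∧ Prop. 2.3 ⟹ (2.88)» (`B6Ineq288Edge.ineq288_of_printed`)
  FIRED on the genuine `k`-level family: both typed antecedents are now theorems on ONE family (`prop22Printed_kLevelP` of
  gen 12 and `prop23Printed_kLevelP`), so the edge's conclusion — (2.88) for every member, under the edge's located
  reading of the outer kernels and its per-member Lemma-2.1 / threshold hypotheses (unchanged, NOT discharged here) — holds
  on `geoP` with the genuine `gpP`, `CinvP`.

## HONEST SCOPE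

As `B6Prop23MultiLevelBox` (first printed prescription for `C_□`, levels `1 … k` on a Neumann box, `m² = 0`, `R ≥ 2L`,
`L ≥ 2`, constants depending on `d`, `L`); the census hypothesis `Hyp21_22` of the member is `True` (the located (2.1)–(2.2)
are the fields of `D`) and is not used.  The census exponent `d` is instantiated at the lattice dimension `d + 1` of
the box model.  Nothing is inferred from the manuscript: every step is kernel-checked.
-/

namespace Literature.MathematicalPhysics.QuantumFieldTheory.Balaban1983to89.B6Prop23KLevelCensusL0

open Finset Matrix
open Literature.MathematicalPhysics.QuantumFieldTheory.Balaban1983to89.B4Reflection242 (boxDom)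
open Literature.MathematicalPhysics.QuantumFieldTheory.Balaban1983to89.B6MultiLevelBoxOperator hiding Domains mlOp_apply
open Literature.MathematicalPhysics.QuantumFieldTheory.Balaban1983to89.B6MultiLevelBoxOperatorL0
open Literature.MathematicalPhysics.QuantumFieldTheory.Balaban1983to89.B6Geom246MultiLevelBox hiding Touch blkOf blkOf_corner blkOf_eq_iff_blk blkOf_eq_of_blk_i_eq blkOf_val bond bond_adj bset cen connected coord_bounds corner corner_mem csys dist_blkOf_le_box dist_blkOf_le_coord dist_blkOf_le_line dist_cen_le_of_adj dist_cen_le_of_touch dist_le_one_of_near dist_toR_cen_le exists_blkOf_eq geom lemma21_box lev_corner lev_eq_of_blkOf_eq levelGap pack reachable_blkOf reachable_of_near realizes scale_bounds touch_symm triangle_refl_nonneg walk_disp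
open Literature.MathematicalPhysics.QuantumFieldTheory.Balaban1983to89.B6Geom246MultiLevelBoxL0
open Literature.MathematicalPhysics.QuantumFieldTheory.Balaban1983to89.B6Ineq268MultiLevelBox hiding QB QB_apply QsB QsB_apply W W_eq W_pos Xk abs_qB abs_qB_le card_blkOf_le csysB geomB geomB_L geomB_M geomB_R geomB_RM geomB_RM_nonneg geomB_Site geomB_dist geomB_eta geomB_len geom_len ineq268_multiLevelBox instDecidableEqGeomBSite kerOp_Xk levelSepB qB qB_ne_zero realizesB refl_nonnegB sum_abs_qB_le symmB triangleB
open Literature.MathematicalPhysics.QuantumFieldTheory.Balaban1983to89.B6Ineq268MultiLevelBoxL0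
open Literature.MathematicalPhysics.QuantumFieldTheory.Balaban1983to89.B6Ineq281MultiLevelBoxL0 (wform_Xk)
open Literature.MathematicalPhysics.QuantumFieldTheory.Balaban1983to89.B6Prop23MultiLevelBoxL0 (prop23_multiLevelBox)
open Literature.MathematicalPhysics.QuantumFieldTheory.Balaban1983to89.B6Expansion282 (kerOp)
open Literature.MathematicalPhysics.QuantumFieldTheory.Balaban1983to89.B6Prop23Chain (mat)
open Literature.MathematicalPhysics.QuantumFieldTheory.Balaban1983to89.B6QGQCoerciveMultiLevelBox (one_le_N0)
open Literature.MathematicalPhysics.QuantumFieldTheory.Balaban1983to89.B6Prop22KLevelCensus hiding KIdx kLevel_nonvacuous kLevel_nonvacuous3 prop22_entry1_kLevel prop22_supEntries126_kLevel prop22_supEntries_kLevel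
open Literature.MathematicalPhysics.QuantumFieldTheory.Balaban1983to89.B6Prop22KLevelCensusL0
open Literature.MathematicalPhysics.QuantumFieldTheory.Balaban1983to89.B6Prop22KLevelCensusEtaL0 (nK nK_pos geoP gpP geoP_len kLevelP_nonvacuous)
open Literature.MathematicalPhysics.QuantumFieldTheory.Balaban1983to89.B6Prop22KLevelCensusEtaUnifL0 (prop22Printed_kLevelP)
open Literature.MathematicalPhysics.QuantumFieldTheory.Balaban1983to89.B6Ineq288Edge (ineq288_of_printed)
open Literature.MathematicalPhysics.QuantumFieldTheory.Balaban1983to89.B6RandomWalk (Triangle254 Ineq260)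
open Literature.MathematicalPhysics.QuantumFieldTheory.Balaban1983to89.B6Lemma21Repaired (Ineq261With)
open Literature.MathematicalPhysics.QuantumFieldTheory.Balaban1983to89.B6Cor28 (Ineq288)
open Literature.MathematicalPhysics.QuantumFieldTheory.Balaban1983to89.B6 (Geometry SiteKernel Prop23Printed pref4)

noncomputable section

variable {d : ℕ}

/-! ## §1 The inverse of `Q′G′²Q′*` of a member and its kernel in print's units -/

section Member

variable {ℓ : ℕ} (i : KIdx d ℓ)

/-- **`Q′G′²Q′*` OF THE MEMBER** as an operator on `ℝ^𝔅` in the pairing (2.69) (lattice units), `G′ = gml` genuine with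
the printed weights. [cite: Balaban1984PropagatorsII, (2.69) p.235] -/
def Xop : Module.End ℝ (↥(bset i.D) → ℝ) := kerOp (W i.D) (Xk i.D (fun j => aPrinted ℓ 1 (j + 1)))

/-- `G′` of the member is a left inverse of `Δ′_a` (LEVEL-0 TWIN: every weight, the level-`0` one included, is a genuine
printed weight `a_{j+1} > 0` — no `mlOp_congr_weights` device).
[cite: Balaban1984PropagatorsII, p.225 («G′ = Δ′_a^{−1} is a well defined … operator»), (2.3) p.224, (2.14) p.225 (j = 0 admitted)] -/
theorem mlOp_mul_gml_member (hℓ : 1 ≤ ℓ) :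
    mlOp i.NB ℓ i.k i.D.lev (fun j => aPrinted ℓ 1 (j + 1)) * gml i.NB ℓ i.k i.D.lev (fun j => aPrinted ℓ 1 (j + 1)) = 1 :=
  mlOp_mul_gml (one_le_N0 i.hMh i.hP) i.D.lev_le
    fun j => (aPrinted_window hℓ one_pos (Nat.succ_le_succ (Nat.zero_le j))).2.2

/-- **`Q′G′²Q′*` IS INJECTIVE** on `ℝ^𝔅`: `⟨f, Q′G′²Q′*f⟩_W = ‖G′Q′*f‖²` and `G′`, `Q′*` are injective («Of course the
operator Q′G′²Q′* is positive definite, so its inverse is well defined»). [cite: Balaban1984PropagatorsII, p.235 (before (2.70))] -/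
theorem Xop_injective (hℓ : 1 ≤ ℓ) : Function.Injective (Xop i) := by
  refine (injective_iff_map_eq_zero _).2 fun f hf => ?_
  have hw := wform_Xk i.D (fun j => aPrinted ℓ 1 (j + 1)) f f
  have h0 : ∑ y, W i.D y * f y * (kerOp (W i.D) (Xk i.D (fun j => aPrinted ℓ 1 (j + 1))) f) y = 0 := by
    refine Finset.sum_eq_zero fun y _ => ?_
    have : (kerOp (W i.D) (Xk i.D (fun j => aPrinted ℓ 1 (j + 1))) f) y = 0 := by
      have := congrArg (fun g => g y) (show Xop i f = 0 from hf); simpa [Xop] using this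
    rw [this, mul_zero]
  rw [h0] at hw
  have hv : gml i.NB ℓ i.k i.D.lev (fun j => aPrinted ℓ 1 (j + 1)) *ᵥ QsB i.D f = 0 := dotProduct_self_eq_zero.1 hw.symm
  have hQ : QsB i.D f = 0 := by
    have := congrArg (fun v => mlOp i.NB ℓ i.k i.D.lev (fun j => aPrinted ℓ 1 (j + 1)) *ᵥ v) hv
    simpa [Matrix.mulVec_mulVec, mlOp_mul_gml_member i hℓ] using this
  funext y
  obtain ⟨x, hx⟩ := exists_blkOf_eq i.D y
  have := congrArg (fun v => v x) hQ
  simp only [QsB_apply, hx, Pi.zero_apply] at this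
  exact this

/-- `Q′G′²Q′*` of the member is invertible. [cite: Balaban1984PropagatorsII, p.235 («so its inverse is well defined»)] -/
theorem Xop_isUnit (hℓ : 1 ≤ ℓ) : IsUnit (Xop i) :=
  (LinearMap.isUnit_iff_ker_eq_bot _).2 (LinearMap.ker_eq_bot.2 (Xop_injective i hℓ))

open Classical in
/-- **`(Q′G′²Q′*)⁻¹` OF THE MEMBER** (the inverse operator when `L ≥ 2`; `0` in the degenerate case `ℓ = 0`, never used).
[cite: Balaban1984PropagatorsII, Prop. 2.3 (2.86) p.238] -/
def Ginv : Module.End ℝ (↥(bset i.D) → ℝ) := if h : 1 ≤ ℓ then ↑((Xop_isUnit i h).unit⁻¹) else 0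

/-- `(Q′G′²Q′*)⁻¹·(Q′G′²Q′*) = 1`. [cite: Balaban1984PropagatorsII, Prop. 2.3 (2.86) p.238] -/
theorem Ginv_mul (hℓ : 1 ≤ ℓ) : Ginv i * Xop i = 1 := by
  unfold Ginv
  rw [dif_pos hℓ]
  nth_rewrite 2 [← (Xop_isUnit i hℓ).unit_spec]
  exact Units.inv_mul _

/-- **THE CARRIER KERNEL OF `(Q′G′²Q′*)⁻¹` IN PRINT'S UNITS**: `Cinv(y, y′) = η^{−4−(d+1)}·Ginv(y, y′)/(L^{j′})^{d+1}`
(`G′ ↦ η²G′` makes `Q′G′²Q′* ↦ η⁴·`, the (2.69) weight `(L^{j′}η)^{d+1} = η^{d+1}(L^{j′})^{d+1}`).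
[cite: Balaban1984PropagatorsII, (2.69) p.235, (2.87) p.238, dictionary] -/
def CinvP : SiteKernel (geoP i) :=
  ⟨fun y y' => (((nK i : ℕ) : ℝ)) ^ (4 + (d + 1)) * (mat (Ginv i) y y' / W i.D y')⟩

/-- the kernel, unfolded. [cite: Balaban1984PropagatorsII, (2.87) p.238, dictionary] -/
theorem CinvP_ker (y y' : ↥(bset i.D)) :
    (CinvP i).ker y y' = (((nK i : ℕ) : ℝ)) ^ (4 + (d + 1)) * (mat (Ginv i) y y' / W i.D y') := rfl

end Member

/-! ## §2 Proposition 2.3 in the census typing on the genuine `k`-level family -/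

/-- print-unit powers: `(L^j·η)^{−m} = η^{−m}·(L^j)^{−m}` with `η^{−m} = (η⁻¹)^m`, `η⁻¹ = L^k`. [cite: Balaban1984PropagatorsII, (2.87) p.238, dictionary] -/
private theorem rpow_len_eta {t n : ℝ} (ht : 0 < t) (hn : 0 < n) (m : ℕ) :
    (t * n⁻¹) ^ (-(m : ℝ)) = n ^ m * t ^ (-(m : ℝ)) := by
  rw [Real.mul_rpow ht.le (inv_nonneg.2 hn.le), Real.inv_rpow hn.le, Real.rpow_neg hn.le, inv_inv,
    Real.rpow_natCast, mul_comm]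

/-- **[B6] PROPOSITION 2.3 (2.86)–(2.87) IN THE CENSUS TYPING, ON THE GENUINE `k`-LEVEL FAMILY IN PRINT'S UNITS**:
`B6.Prop23Printed (d + 1) geoP CinvP` — «∃ M₁ δ₁ C > 0 ∀ i, (2.1)–(2.2) → M₁ ≤ M → ∀ y y′,
|(Q′G′²Q′*)⁻¹(y, y′)| ≤ C(L^jη)^{−4}(L^{j′}η)^{−(d+1)}e^{−½δ₁d(y,y′)}» for EVERY nested box family with `k` levels,
`G′ = Δ′_a⁻¹` genuine, `Cinv` = the (2.69)-kernel of the inverse; witnesses from `B6Prop23MultiLevelBoxL0.prop23_multiLevelBox`.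
[cite: Balaban1984PropagatorsII, Prop. 2.3 (2.86)–(2.87) p.238] -/
theorem prop23Printed_kLevelP (d ℓ : ℕ) (hℓ : 1 ≤ ℓ) :
    Prop23Printed (d + 1) (fun i : KIdx d ℓ => geoP i) (fun i => CinvP i) := by
  -- the printed weights `a_j = aPrinted 1 j ∈ [1 − L⁻², 1]`, `c_j = 1`
  have hL2 : (1 : ℝ) < ((ℓ : ℝ) + 1) ^ 2 := by
    have : (2 : ℝ) ≤ (ℓ : ℝ) + 1 := by
      have : (1 : ℝ) ≤ ℓ := by exact_mod_cast hℓ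
      linarith
    nlinarith
  have hamin : (0 : ℝ) < 1 - ((((ℓ : ℝ) + 1)) ^ 2)⁻¹ := by
    rw [sub_pos]; exact inv_lt_one_of_one_lt₀ hL2
  obtain ⟨hwin, hrec⟩ := B6Prop22KLevelCensusL0.KIdx.aPrinted_windows hℓ
  obtain ⟨δ₁, C, M₀, hδ₁, hC, hM₀, h⟩ := prop23_multiLevelBox d ℓ hℓ (1 - ((((ℓ : ℝ) + 1)) ^ 2)⁻¹) 1 1 1 hamin one_pos
  refine ⟨M₀, δ₁, C, hM₀, hδ₁, hC, fun i _ hM y y' => ?_⟩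
  obtain ⟨G, -, -, -, huniq, hb, -⟩ := h i.k i.Mh i.R hM i.hR i.P i.hP i.D (fun j => aPrinted ℓ 1 (j + 1)) (fun _ => 1) hwin
    (fun _ => ⟨le_rfl, le_rfl⟩) hrec
  have hG : Ginv i = G := huniq _ (Ginv_mul i hℓ)
  have hη := nK_pos i
  have hLj : ∀ s : ↥(bset i.D), (0 : ℝ) < ((ℓ : ℝ) + 1) ^ s.1.1 := fun s => by positivity
  have hby := hb y y'
  rw [← hG, geom_len, geom_len, mul_one, mul_one] at hby
  show |(((nK i : ℕ) : ℝ)) ^ (4 + (d + 1)) * (mat (Ginv i) y y' / W i.D y')| ≤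
    C * (((ℓ : ℝ) + 1) ^ y.1.1 * (((nK i : ℕ) : ℝ))⁻¹) ^ (-(4 : ℝ)) *
      (((ℓ : ℝ) + 1) ^ y'.1.1 * (((nK i : ℕ) : ℝ))⁻¹) ^ (-((d + 1 : ℕ) : ℝ)) *
      Real.exp (-(δ₁ / 2 * (geom i.D).dist y y'))
  have e4 := rpow_len_eta (hLj y) hη 4
  have ed := rpow_len_eta (hLj y') hη (d + 1)
  push_cast at e4
  rw [abs_mul, abs_of_pos (pow_pos hη _), e4, ed, pow_add]
  have hP : (0 : ℝ) ≤ (((nK i : ℕ) : ℝ)) ^ 4 * (((nK i : ℕ) : ℝ)) ^ (d + 1) := by positivity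
  calc (((nK i : ℕ) : ℝ)) ^ 4 * (((nK i : ℕ) : ℝ)) ^ (d + 1) * |mat (Ginv i) y y' / W i.D y'|
      ≤ (((nK i : ℕ) : ℝ)) ^ 4 * (((nK i : ℕ) : ℝ)) ^ (d + 1) * (C * (((ℓ : ℝ) + 1) ^ y.1.1) ^ (-(4 : ℝ)) *
          (((ℓ : ℝ) + 1) ^ y'.1.1) ^ (-((d + 1 : ℕ) : ℝ)) * Real.exp (-(δ₁ / 2 * (geom i.D).dist y y'))) :=
        mul_le_mul_of_nonneg_left hby hP
    _ = _ := by ring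

/-- **NON-VACUITY**: above every threshold there are members with `k ≥ 2` genuine levels (gen 12's `kLevelP_nonvacuous`),
so the inhabited census fact constrains actual carriers. [cite: Balaban1984PropagatorsII, (2.1)–(2.4) p.224, bookkeeping] -/
theorem prop23Printed_kLevelP_nonvacuous (d ℓ k : ℕ) (hk : 2 ≤ k) (M₁ : ℝ) :
    ∃ i : B6Prop22KLevelCensusL0.KIdx d ℓ, i.k = k ∧ M₁ ≤ (geoP i).M ∧ (geoP i).Hyp21_22 :=
  let ⟨i, h1, h2, h3, _, _⟩ := kLevelP_nonvacuous d ℓ k hk M₁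
  ⟨i, h1, h2, h3⟩

/-! ## §3 The census edge «Prop. 2.2 ∧ Prop. 2.3 ⟹ (2.88)» fired on the genuine `k`-level family -/

/-- **THE DAG EDGE (2.88) ON THE GENUINE `k`-LEVEL FAMILY** («We have from Lemma 2.1, Proposition 2.2 and (2.87) …
(2.88)»): `B6Ineq288Edge.ineq288_of_printed` with BOTH typed antecedents discharged on the family `geoP` — Prop. 2.2 by
gen 12's `prop22Printed_kLevelP`, Prop. 2.3 by `prop23Printed_kLevelP`.  The remaining hypotheses (the located reading of
the outer kernels `K₁ = ∂_μG′Q′*`, `K₃ = Q′G′∂_ν*` through entries of (2.67), Lemma 2.1 at `(δ, α)` per member and the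
three thresholds) are those of the edge, verbatim, and are NOT discharged here.
[cite: Balaban1984PropagatorsII, (2.88) p.238; Prop. 2.2 p.234; Prop. 2.3 p.238] -/
theorem ineq288_edge_kLevelP (d ℓ : ℕ) (hℓ : 1 ≤ ℓ) :
    ∃ M₂ δ₀ δ₁ C' C'' : ℝ, 0 < M₂ ∧ 0 < δ₀ ∧ 0 < δ₁ ∧ 0 < C' ∧ 0 < C'' ∧
      ∀ i : KIdx d ℓ, (geoP i).Hyp21_22 → M₂ ≤ (geoP i).M → Triangle254 (geoP i) →
        (∀ y y', 0 ≤ (geoP i).dist y y') →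
        (∀ a b : (geoP i).Site, (geoP i).dist a b = (geoP i).dist b a) → 1 ≤ (geoP i).L → 0 < (geoP i).eta →
        ∀ (n₁ n₃ : Fin 4), (∀ t, pref4 t n₁ = t) → (∀ t, pref4 t n₃ = t) →
        ∀ (K₁ K₃ : (geoP i).Site → (geoP i).Site → ℝ) (lam₁ lam₃ : (geoP i).Site → (geoP i).Loc) (cQ : ℝ),
          0 ≤ cQ →
          (∀ y₁, (geoP i).suppIn (lam₁ y₁) y₁) → (∀ y₁, (geoP i).supNorm (lam₁ y₁) ≤ cQ) →
          (∀ y₂, (geoP i).suppIn (lam₃ y₂) y₂) → (∀ y₂, (geoP i).supNorm (lam₃ y₂) ≤ cQ) →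
          (∀ y y₁, |K₁ y y₁| ≤ (gpP i).e n₁ (lam₁ y₁) y) →
          (∀ y₂ y', |K₃ y₂ y'| ≤ (gpP i).e n₃ (lam₃ y₂) y') →
        ∀ (δ α cL : ℝ), 0 ≤ δ → 0 < α → α < 1 →
          δ + 2 * (α * δ) ≤ δ₀ / 2 → δ + α * δ ≤ δ₁ / 2 →
          Ineq260 (geoP i) δ α → Ineq261With cL (geoP i) δ α →
          (geoP i).L ^ (4 : ℝ) ≤ Real.exp (α * δ * (geoP i).R * (geoP i).M) →
          (geoP i).L ^ ((d + 1 : ℕ) : ℝ) ≤ Real.exp (α * δ * (geoP i).R * (geoP i).M) →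
          (geoP i).L ^ (1 : ℝ) ≤ Real.exp (α * δ * (geoP i).R * (geoP i).M) →
          Ineq288 (geoP i) (d + 1) K₁ (CinvP i).ker K₃
            (C' * cQ * C'' * (C' * cQ) * (geoP i).L ^ (4 : ℝ) * (geoP i).L ^ ((d + 1 : ℕ) : ℝ) *
              (geoP i).L ^ (1 : ℝ) * cL ^ 3) ((1 - α) * δ) :=
  ineq288_of_printed (d + 1) (fun i : KIdx d ℓ => geoP i) (fun i => gpP i) (fun i => CinvP i)
    (prop22Printed_kLevelP d ℓ hℓ) (prop23Printed_kLevelP d ℓ hℓ)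

end

end Literature.MathematicalPhysics.QuantumFieldTheory.Balaban1983to89.B6Prop23KLevelCensusL0
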